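import Summits.CriticalPhenomena.PercolationContinuityZ3.Theorems.PercNearOneGluingNoHeavyLowerTailKNGoodGCThreeMultiSorted
import Summits.CriticalPhenomena.PercolationContinuityZ3.Theorems.PercNearOneGluingNoHeavyLowerTailKNGoodBranching
import Summits.CriticalPhenomena.PercolationContinuityZ3.Theorems.PercNearOneGluingNoHeavyLowerTailStarPatternForcing
import Summits.CriticalPhenomena.PercolationContinuityZ3.Theorems.PercNearOneGluingNoHeavyLowerTailKernelTools
import HarnessLib

/-!
# THEOREM A: at three relays, an observer with ANY NUMBER of pendant-star children is Kozma–Nitzan-good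
# (`NoHeavyLowerTail` cell, stmt-CriticalPhenomena-4575; prover `prim-hp-2`, gen 14; memo MEMO-gen14 §7)

Support file (`--supports stmt-CriticalPhenomena-4575`).  No definitions, no named facts, no sorries.

* `KNGoodGC3Multi.agood_forced_multi` — the m-star gluing inequality GC₃^{(m)} (`agood_forced_multi_sorted` with the relays sorted inside and the
  full loneliness hypothesis of the witness).
* `KNGoodGC3Multi.knGood_pendantStars_threeRelays` — **`o ∉ A = {a₁,a₂,a₃}` with relay hairs and a finite set `X` of children, each a pendant
  star into `A` (pairs only to `o` and to `A`), over an ARBITRARY core: `KNGood w A hA o b`.**  Proof: Kozma–Nitzan's star-peeling reduction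
  (`KNGoodBranching.knGood_of_starNeed`, witness `a₀ = argmin_{G∖o}`); for each nonempty star `B ⊆ X`, conditioning on `σ_B` is forcing
  (`UpsetExchange.real_inter_starEvent_eq_mul_forced`), and the forced functional is non-negative by `agood_forced_multi`; the pocket minima
  of the forced graph and of `G` agree (`KNSep.real_eq_of_agree`, the pockets contain `o`).
  m = 1 is Theorem 5 (+ hairs), m = 2 is GC₃ (`KNGoodGC3.knGood_twoPendantStars_threeRelays`, gen 12); m ≥ 3 is new.
  (The loop `s(o,o)` is assumed to have weight `0`; loops never matter.)
[cite: KozmaNitzan2024, Thms. 4–5 (pp. 12–14), Lemma 5 (p. 13), §3.2 Definition (p. 12); VandenbergHaggstromKahn2005, Thm. 1.5 (p. 7)]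
-/

noncomputable section

namespace Summit.CriticalPhenomena.PercolationContinuityZ3.Theorems

open MeasureTheory Set Literature.Probability.LatticeModels Literature.Probability.Percolation
open scoped Classical BigOperators

variable {n : ℕ}

namespace KNGoodGC3Multi

open ChampionStability KNGoodAux KNGoodHair KNGoodSeries KNGoodPortFree KNGoodTwoTwo KNGoodGC3 KNSep

/-- **GC₃ for any number of pendant-star children, forced-graph form** (relays sorted inside; witness `j` lonelier in `G ∖ o` than every relay).
[cite: KozmaNitzan2024, Thms. 4–5 (pp. 12–14), Lemma 5 (p. 13); VandenbergHaggstromKahn2005, Thm. 1.5 (p. 7)] -/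
theorem agood_forced_multi (w : Sym2 (Fin n) → unitInterval) (A : Finset (Fin n)) (hA : A.Nonempty)
    (o b a₁ a₂ a₃ j : Fin n) (hAeq : A = {a₁, a₂, a₃}) (h12 : a₁ ≠ a₂) (h13 : a₁ ≠ a₃) (h23 : a₂ ≠ a₃)
    (ho : o ∉ A) (hbo : b ≠ o) (hjA : j ∈ A)
    (B : Finset (Fin n)) (hoB : o ∉ B)
    (hB : ∀ x ∈ B, x ∉ A ∧ b ≠ x ∧ ∀ z : Fin n, z ∉ A → z ≠ o → w s(x, z) = 0)
    (hmin : ∀ a ∈ A, (prodBernoulli (restrW ({o}ᶜ : Set (Fin n)) w)).real (openConn j b) ≤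
      (prodBernoulli (restrW ({o}ᶜ : Set (Fin n)) w)).real (openConn a b)) :
    (prodBernoulli (fun e : Sym2 (Fin n) => if o ∈ e then (if ∃ p ∈ B, e = s(o, p) then 1 else 0) else w e)).real (openConn j b) ≤
      (prodBernoulli (fun e : Sym2 (Fin n) => if o ∈ e then (if ∃ p ∈ B, e = s(o, p) then 1 else 0) else w e)).real (openConn o b) +
        ∑ W ∈ nullSets A, (prodBernoulli (fun e : Sym2 (Fin n) => if o ∈ e then (if ∃ p ∈ B, e = s(o, p) then 1 else 0) else w e)).real
            (clusterIs o W) *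
          A.inf' hA (fun a' => (prodBernoulli (fun e : Sym2 (Fin n) => if o ∈ e then (if ∃ p ∈ B, e = s(o, p) then 1 else 0) else w e)).real
            (openConnIn ((↑W : Set (Fin n))ᶜ) a' b)) := by
  obtain ⟨b₁, b₂, b₃, hP, hb12, hb13, hb23, hs12, hs23⟩ :=
    exists_sorted_three (fun a => (prodBernoulli (fun f : Sym2 (Fin n) => if (∃ v ∈ B, v ∈ f) then (0 : unitInterval) else
      restrW ({o}ᶜ : Set (Fin n)) w f)).real (openConn a b)) a₁ a₂ a₃ h12 h13 h23
  have hAeq' : A = {b₁, b₂, b₃} := hAeq.trans hP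
  have hb₁ : b₁ ∈ A := by rw [hAeq']; simp
  exact agood_forced_multi_sorted w A hA o b b₁ b₂ b₃ j hAeq' hb12 hb13 hb23 ho hbo hjA B hoB hB hs12 hs23 (hmin b₁ hb₁)

open KNGoodBranching UpsetExchange in
/-- **THEOREM A.**  `o ∉ A = {a₁,a₂,a₃}`, `X` a finite set of children (`o ∉ X`, `X ∩ A = ∅`, `b ∉ X ∪ {o}`); the pairs at `o` go to `A ∪ X`
(arbitrary weights; the loop at `o` has weight `0`); every child is a pendant star into `A` (no positive pair except to `o` and to `A`); the
core is arbitrary.  Then `(G, A, o, b)` is good. [cite: KozmaNitzan2024, Thms. 4–5 (pp. 12–14), Lemma 5 (p. 13), §3.2 Definition (p. 12)] -/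
theorem knGood_pendantStars_threeRelays (w : Sym2 (Fin n) → unitInterval) (A : Finset (Fin n)) (hA : A.Nonempty)
    (o b a₁ a₂ a₃ : Fin n) (hAeq : A = {a₁, a₂, a₃}) (h12 : a₁ ≠ a₂) (h13 : a₁ ≠ a₃) (h23 : a₂ ≠ a₃)
    (ho : o ∉ A) (hbo : b ≠ o) (X : Finset (Fin n)) (hoX : o ∉ X) (hXA : ∀ x ∈ X, x ∉ A) (hbX : b ∉ X)
    (hloop : w s(o, o) = 0)
    (hoN : ∀ v : Fin n, v ≠ o → v ∉ A → v ∉ X → w s(o, v) = 0)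
    (hX : ∀ x ∈ X, ∀ z : Fin n, z ∉ A → z ≠ o → w s(x, z) = 0) :
    KNGood w A hA o b := by
  haveI : ∀ v : Sym2 (Fin n) → unitInterval, IsProbabilityMeasure (prodBernoulli v) := fun v => inferInstance
  set μ := prodBernoulli w with hμ
  -- the witness: the loneliest relay of `G ∖ o`
  obtain ⟨a₀, ha₀, hmin⟩ := A.exists_min_image (fun a => μ.real (openConnIn ({o}ᶜ : Set (Fin n)) a b)) hA
  have ha₀o : a₀ ≠ o := fun h => ho (h ▸ ha₀)
  refine knGood_of_starNeed w A X hA o b ho hoX hoN a₀ ha₀ hmin ?_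
  intro B hBX hBne
  have hoB : o ∉ B := fun h => hoX (hBX h)
  have hB' : ∀ x ∈ B, x ∉ A ∧ b ≠ x ∧ ∀ z : Fin n, z ∉ A → z ≠ o → w s(x, z) = 0 :=
    fun x hx => ⟨hXA x (hBX hx), fun h => hbX (h ▸ hBX hx), hX x (hBX hx)⟩
  -- the loneliness hypothesis in `restrW` form
  have hmin' : ∀ a ∈ A, (prodBernoulli (restrW ({o}ᶜ : Set (Fin n)) w)).real (openConn a₀ b) ≤
      (prodBernoulli (restrW ({o}ᶜ : Set (Fin n)) w)).real (openConn a b) := by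
    intro a ha
    have hao : a ≠ o := fun h => ho (h ▸ ha)
    rw [restrW_real_openConn w o ha₀o b, restrW_real_openConn w o hao b]
    exact hmin a ha
  have key := agood_forced_multi w A hA o b a₁ a₂ a₃ a₀ hAeq h12 h13 h23 ho hbo ha₀ B hoB hB' hmin'
  set WB : Sym2 (Fin n) → unitInterval := fun e => if o ∈ e then (if ∃ p ∈ B, e = s(o, p) then 1 else 0) else w e with hWB
  -- conditioning on the star is forcing
  have F : ∀ Y : Set (BondConfig (Fin n)), μ.real (Y ∩ starEvent o (↑B : Set (Fin n))) =
      μ.real (starEvent o (↑B : Set (Fin n))) * (prodBernoulli WB).real Y :=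
    fun Y => real_inter_starEvent_eq_mul_forced w o B hoB hloop Y
  set c : Finset (Fin n) → ℝ := fun W => A.inf' hA (fun a => μ.real (openConnIn ((↑W : Set (Fin n))ᶜ) a b)) with hc
  set cB : Finset (Fin n) → ℝ := fun W => A.inf' hA (fun a => (prodBernoulli WB).real (openConnIn ((↑W : Set (Fin n))ᶜ) a b)) with hcB
  have hsum : ∑ W ∈ (nullSets A).erase {o}, μ.real (clusterIs o W ∩ starEvent o (↑B : Set (Fin n))) * c W =
      μ.real (starEvent o (↑B : Set (Fin n))) * ∑ W ∈ (nullSets A).erase {o}, (prodBernoulli WB).real (clusterIs o W) * c W := by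
    rw [Finset.mul_sum]
    refine Finset.sum_congr rfl fun W _ => ?_
    rw [F (clusterIs o W)]; ring
  rw [F (openConn a₀ b), F (openConn o b), hsum]
  have hσ : 0 ≤ μ.real (starEvent o (↑B : Set (Fin n))) := measureReal_nonneg
  -- the forced functional with the pockets of `G`
  have hc0 : ∀ W, 0 ≤ c W := fun W => (Finset.le_inf'_iff hA _).2 fun a _ => measureReal_nonneg
  have hcB0 : ∀ W, 0 ≤ cB W := fun W => (Finset.le_inf'_iff hA _).2 fun a _ => measureReal_nonneg
  -- (i) the term `W = {o}` of the forced functional vanishes: `o` has a sure pair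
  obtain ⟨p, hp⟩ := hBne
  have hop : o ≠ p := fun h => hoB (h ▸ hp)
  have hWBp : WB s(o, p) = 1 := by
    simp only [hWB, Sym2.mem_mk_left, if_true]; rw [if_pos ⟨p, hp, rfl⟩]
  have h0 : (prodBernoulli WB).real (clusterIs o ({o} : Finset (Fin n))) = 0 := by
    have hsub : (clusterIs o ({o} : Finset (Fin n)) : Set (BondConfig (Fin n))) ⊆ (openConn o p)ᶜ := by
      intro ω hω hreach
      rw [mem_clusterIs, Finset.coe_singleton] at hω
      have : p ∈ openCluster ω o := hreach
      rw [hω, mem_singleton_iff] at this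
      exact hop this.symm
    have hz := real_not_openConn_eq_zero_of_surePair WB o p hop hWBp
    exact le_antisymm ((measureReal_mono hsub).trans (le_of_eq hz)) measureReal_nonneg
  have hmemW : ({o} : Finset (Fin n)) ∈ nullSets A := by
    rw [mem_nullSets, Finset.disjoint_singleton_left]; exact ho
  have hsplit : ∑ W ∈ nullSets A, (prodBernoulli WB).real (clusterIs o W) * cB W =
      ∑ W ∈ (nullSets A).erase {o}, (prodBernoulli WB).real (clusterIs o W) * cB W := by
    rw [← Finset.add_sum_erase _ _ hmemW, h0, zero_mul, zero_add]
  -- (ii) on realizable pockets the forced graph and `G` have the same pocket minima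
  have hterm : ∀ W ∈ (nullSets A).erase {o}, (prodBernoulli WB).real (clusterIs o W) * cB W ≤ (prodBernoulli WB).real (clusterIs o W) * c W := by
    intro W _
    by_cases hz : (prodBernoulli WB).real (clusterIs o W) = 0
    · rw [hz, zero_mul, zero_mul]
    · have hoW : o ∈ W := by
        by_contra hoW
        apply hz
        have : (clusterIs o W : Set (BondConfig (Fin n))) = ∅ := by
          ext ω
          simp only [mem_empty_iff_false, iff_false]
          intro hω
          rw [mem_clusterIs] at hω
          have : o ∈ (↑W : Set (Fin n)) := by rw [← hω]; exact mem_openCluster_self ω o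
          exact hoW (Finset.mem_coe.1 this)
        rw [this, measureReal_empty]
      have hcc : cB W = c W := by
        simp only [hcB, hc]
        congr 1
        funext a
        refine real_eq_of_agree WB w (((↑W : Set (Fin n))ᶜ).sym2) (fun e he => ?_)
          (DCT16.determinedBy_openConnIn _ a b subset_rfl)
        induction e using Sym2.ind with
        | h p' q' =>
          rw [Set.mk_mem_sym2_iff] at he
          have hoe : o ∉ s(p', q') := by
            intro hm
            rcases Sym2.mem_iff.1 hm with h | h
            · exact he.1 (h ▸ Finset.mem_coe.2 hoW)
            · exact he.2 (h ▸ Finset.mem_coe.2 hoW)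
          simp only [hWB, hoe, if_false]
      rw [hcc]
  have hle : ∑ W ∈ nullSets A, (prodBernoulli WB).real (clusterIs o W) * cB W ≤
      ∑ W ∈ (nullSets A).erase {o}, (prodBernoulli WB).real (clusterIs o W) * c W := by
    rw [hsplit]; exact Finset.sum_le_sum hterm
  have key' : (prodBernoulli WB).real (openConn a₀ b) ≤ (prodBernoulli WB).real (openConn o b) +
      ∑ W ∈ (nullSets A).erase {o}, (prodBernoulli WB).real (clusterIs o W) * c W := by
    have k := key
    change (prodBernoulli WB).real (openConn a₀ b) ≤ (prodBernoulli WB).real (openConn o b) +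
      ∑ W ∈ nullSets A, (prodBernoulli WB).real (clusterIs o W) * cB W at k
    linarith
  have := mul_le_mul_of_nonneg_left key' hσ
  rw [mul_add] at this
  exact this

end KNGoodGC3Multi

end Summit.CriticalPhenomena.PercolationContinuityZ3.Theorems
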